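import Literature.NumberTheory.Automorphic.SL2AwayRelativeElementary
import Mathlib.NumberTheory.LSeries.PrimesInAP
import Mathlib.Data.ZMod.QuotientRing
import Mathlib.FieldTheory.Finite.Basic
import Mathlib.NumberTheory.Padics.PadicVal.Basic
import HarnessLib

/-!
# Serre's congruence subgroup property for `SL₂(ℤ[1/m])` — proofs, A-I: the arithmetic of
# `A = ℤ[1/m]` (quotients, Dirichlet's theorem in `A`, Serre's Lemme 3)

Topic `Literature/NumberTheory/Automorphic`; namespace `Literature.NumberTheory.Automorphic`
(sub-namespace `SerreSL2.Away`).  Everything here is PROVED; no definitions, no named facts.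

This is the first file of the DISCHARGE of the tree's named fact
`SerreSL2Congruence1970_congruenceSubgroupProperty_away` (Serre 1970, §2.6 Thm. 2 (b), Cor. 3 at
`K = ℚ`, `S = {∞} ∪ {ℓ ∣ m}`, `A_S = ℤ[1/m] = Localization.Away (m : ℤ)`), along the Moore-free road the
tree already follows for `A = 𝓞_F`, `F` totally real (files `CongruenceSubgroupPropertySL2*.lean`,
I–XX: Vaserstein 1972 Lemmas 1–5, Liehl 1981 §3, Bass–Milnor–Serre Ch. I Thm. 3.6): the number-field
inputs of that road (the ray-class Dirichlet theorem, cyclotomic Chebotarev, Hilbert reciprocity, a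
real place, a unit of infinite order) are replaced, for the principal ideal domain `ℤ[1/m] ⊂ ℚ`, by

* `SerreSL2.Away.exists_coprime_span_natCast_eq` / `exists_coprime_eq_span` — every non-zero ideal of
  `ℤ[1/m]` is `B · ℤ[1/m]` with `B ≥ 1` prime to `m`;
* `SerreSL2.Away.nonempty_zmod_ringEquiv_quotient` — `ℤ[1/m]/(B) ≃ ℤ/B` for `B` prime to `m`
  (so quotients by non-zero ideals are finite, `(p)` is maximal with residue field `𝔽_p` for a prime
  `p ∤ m`, and the units modulo `(p)` have order dividing `p - 1`);
* `SerreSL2.Away.exists_prime_natCast_sub_mem` — **Dirichlet's theorem on primes in arithmetic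
  progressions** (Mathlib `Nat.forall_exists_prime_gt_and_zmodEq`) in `ℤ[1/m]`-form: every class
  modulo `(B)` prime to `B` contains arbitrarily large rational primes;
* `SerreSL2.Away.exists_add_mul_forall_not_dvd_orderOf` — **Serre 1970, §2.2 Lemme 3** (= BMS Ch. I
  Thm. 3.2) for `A = ℤ[1/m]` (`m = Card μ = 2`): for `a, b` coprime, `b ≠ 0`, and a prime `l` there is
  `t` with `a + tb ≠ 0` such that no unit of `A/(a + tb)` has order divisible by `l^{v_l(2)+1}` —
  here `a + tb = ± p` for ONE rational prime `p ≢ 1 (mod l^{v_l(2)+1})` (the sign `-1 ∈ Aˣ` replaces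
  BMS's second prime);
* `SerreSL2.Away.mul_mem_of_units_pow_mul_mem` — the substitute for file VIII (powers of units span
  the field): an additive subgroup of `ℤ[1/m]` stable under `x ↦ vᴺx` for all units `v` is an ideal
  (`ℤ[m^{±N}] = ℤ[1/m]`);
* `SerreSL2.Away.exists_unit_pow_ne_one` — the unit `m` of infinite order (`m ≥ 2`).

## References

* [SerreSL2Congruence1970] J.-P. Serre, Ann. of Math. 92 (1970), §1.1–1.2, §2.2 Lemme 3, §2.3.
* [BassMilnorSerre1967] H. Bass, J. Milnor, J.-P. Serre, Publ. Math. IHES 33 (1967), Ch. I Thm. 3.2,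
  Appendix (A.10)–(A.11).
* [Vaserstein1972SL2] L. N. Vaserstein, Mat. Sb. 89 (131) (1972) 313–322.
-/

open IsLocalization

namespace Literature.NumberTheory.Automorphic

namespace SerreSL2.Away

variable {m : ℕ}

/-! ### Elements and ideals of `ℤ[1/m]` -/

/-- `m` is a unit of `ℤ[1/m]`. [cite: SerreSL2Congruence1970, §1.1] -/
theorem isUnit_natCast_self : IsUnit ((m : ℕ) : Localization.Away (m : ℤ)) := by
  have := IsLocalization.Away.algebraMap_isUnit (S := Localization.Away (m : ℤ)) (m : ℤ)
  simpa using this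

/-- A divisor of `m` is a unit of `ℤ[1/m]`. [cite: SerreSL2Congruence1970, §1.1] -/
theorem isUnit_natCast_of_dvd {g : ℕ} (hg : g ∣ m) : IsUnit ((g : ℕ) : Localization.Away (m : ℤ)) := by
  obtain ⟨k, hk⟩ := hg
  refine isUnit_of_mul_isUnit_left (y := ((k : ℕ) : Localization.Away (m : ℤ))) ?_
  rw [← Nat.cast_mul, ← hk]
  exact isUnit_natCast_self

/-- Every element of `ℤ[1/m]` becomes an integer after multiplication by a power of `m`.
[cite: SerreSL2Congruence1970, §1.1] -/
theorem exists_mul_pow_eq_intCast (x : Localization.Away (m : ℤ)) :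
    ∃ (z : ℤ) (k : ℕ), x * (m : Localization.Away (m : ℤ)) ^ k = z := by
  obtain ⟨⟨z, s⟩, hzs⟩ := IsLocalization.surj (Submonoid.powers (m : ℤ)) x
  obtain ⟨k, hk⟩ := (Submonoid.mem_powers_iff _ _).1 s.2
  refine ⟨z, k, ?_⟩
  have : algebraMap ℤ (Localization.Away (m : ℤ)) s = (m : Localization.Away (m : ℤ)) ^ k := by
    rw [← hk, map_pow, map_natCast]
  rw [← this, hzs, eq_intCast]

/-- For `g ∣ m` and `g ∣ n`: `(n) = (n/g)` in `ℤ[1/m]` (divisors of `m` are units).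
[cite: SerreSL2Congruence1970, §1.1] -/
theorem span_natCast_eq_span_div {n g : ℕ} (hg : g ∣ m) (hgn : g ∣ n) :
    Ideal.span {((n : ℕ) : Localization.Away (m : ℤ))} =
      Ideal.span {(((n / g : ℕ) : ℕ) : Localization.Away (m : ℤ))} := by
  obtain ⟨k, rfl⟩ := hgn
  rcases Nat.eq_zero_or_pos g with rfl | hgpos
  · simp
  rw [Nat.mul_div_cancel_left k hgpos, Nat.cast_mul]
  exact Ideal.span_singleton_mul_left_unit (isUnit_natCast_of_dvd hg) _

/-- **Every principal ideal `(n)`, `n ≥ 1`, of `ℤ[1/m]` is `(B)` with `B ≥ 1` prime to `m`** (strip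
the common factors with `m`, which are units). [cite: SerreSL2Congruence1970, §1.1] -/
theorem exists_coprime_span_natCast_eq (hm : m ≠ 0) {n : ℕ} (hn : n ≠ 0) :
    ∃ B : ℕ, 0 < B ∧ B.Coprime m ∧
      Ideal.span {((n : ℕ) : Localization.Away (m : ℤ))} =
        Ideal.span {((B : ℕ) : Localization.Away (m : ℤ))} := by
  induction n using Nat.strong_induction_on with
  | h n ih =>
    by_cases hc : n.Coprime m
    · exact ⟨n, Nat.pos_of_ne_zero hn, hc, rfl⟩
    · set g := Nat.gcd n m with hg
      have hg0 : g ≠ 0 := by rw [hg]; exact Nat.gcd_ne_zero_right hm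
      have hg1 : 1 < g := by
        by_contra hle
        exact hc (show Nat.gcd n m = 1 by rw [← hg]; omega)
      have hgn : g ∣ n := Nat.gcd_dvd_left n m
      have hgm : g ∣ m := Nat.gcd_dvd_right n m
      have hlt : n / g < n := Nat.div_lt_self (Nat.pos_of_ne_zero hn) hg1
      have hne : n / g ≠ 0 :=
        (Nat.div_pos (Nat.le_of_dvd (Nat.pos_of_ne_zero hn) hgn) (by omega)).ne'
      obtain ⟨B, hB, hBc, hBeq⟩ := ih (n / g) hlt hne
      exact ⟨B, hB, hBc, (span_natCast_eq_span_div hgm hgn).trans hBeq⟩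

/-- **Every non-zero ideal of `ℤ[1/m]` is `(B)` with `B ≥ 1` prime to `m`** (it is extended from its
contraction `(n) ⊆ ℤ`). [cite: SerreSL2Congruence1970, §1.1–1.2] -/
theorem exists_coprime_eq_span (hm : m ≠ 0) {J : Ideal (Localization.Away (m : ℤ))} (hJ : J ≠ ⊥) :
    ∃ B : ℕ, 0 < B ∧ B.Coprime m ∧ J = Ideal.span {((B : ℕ) : Localization.Away (m : ℤ))} := by
  set I : Ideal ℤ := J.under ℤ with hI
  have hmap : I.map (algebraMap ℤ (Localization.Away (m : ℤ))) = J :=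
    IsLocalization.map_under (Submonoid.powers (m : ℤ)) (Localization.Away (m : ℤ)) J
  set n : ℤ := Submodule.IsPrincipal.generator I with hn
  have hIn : I = Ideal.span {n} := (Ideal.span_singleton_generator I).symm
  have hJn : J = Ideal.span {(n : Localization.Away (m : ℤ))} := by
    rw [← hmap, hIn, Ideal.map_span, Set.image_singleton, eq_intCast]
  have hn0 : n ≠ 0 := by
    intro h0
    apply hJ
    rw [hJn, h0, Int.cast_zero, Ideal.span_singleton_eq_bot]
  -- `(n) = (|n|)`
  have habs : Ideal.span {(n : Localization.Away (m : ℤ))} =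
      Ideal.span {((n.natAbs : ℕ) : Localization.Away (m : ℤ))} := by
    rcases Int.natAbs_eq n with h | h
    · conv_lhs => rw [h]
      rw [Int.cast_natCast]
    · conv_lhs => rw [h]
      rw [Int.cast_neg, Int.cast_natCast, Ideal.span_singleton_neg]
  obtain ⟨B, hB, hBc, hBeq⟩ := exists_coprime_span_natCast_eq hm (Int.natAbs_ne_zero.2 hn0)
  exact ⟨B, hB, hBc, hJn.trans (habs.trans hBeq)⟩

/-! ### The quotients `ℤ[1/m]/(B) ≃ ℤ/B` for `B` prime to `m` -/

/-- `1 - (mu)ᵏ ∈ (B)` when `mu ≡ 1 (mod B)`. [folklore] -/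
private theorem one_sub_pow_mem_span {R : Type*} [CommRing R] {x B : R} (h : 1 - x ∈ Ideal.span {B}) (k : ℕ) :
    1 - x ^ k ∈ Ideal.span {B} := by
  have hdvd : 1 - x ∣ 1 - x ^ k := by simpa using sub_dvd_pow_sub_pow (1 : R) x k
  exact (Ideal.span_singleton_le_iff_mem (Ideal.span {B})).2 h (Ideal.mem_span_singleton.2 hdvd)

/-- **Every element of `ℤ[1/m]` is congruent to an integer modulo `(B)`**, `B` prime to `m`
(`z/mᵏ ≡ z uᵏ` for `u m ≡ 1 (mod B)`). [cite: SerreSL2Congruence1970, §1.2] -/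
theorem exists_intCast_sub_mem {B : ℕ} (hBc : B.Coprime m) (x : Localization.Away (m : ℤ)) :
    ∃ z : ℤ, x - z ∈ Ideal.span {((B : ℕ) : Localization.Away (m : ℤ))} := by
  obtain ⟨z, k, hzk⟩ := exists_mul_pow_eq_intCast x
  -- `u m + v B = 1`
  obtain ⟨u, v, huv⟩ : IsCoprime (m : ℤ) (B : ℤ) := (Nat.isCoprime_iff_coprime.2 hBc.symm)
  refine ⟨z * u ^ k, ?_⟩
  have h1 : (1 : Localization.Away (m : ℤ)) - (m : Localization.Away (m : ℤ)) * (u : ℤ) ∈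
      Ideal.span {((B : ℕ) : Localization.Away (m : ℤ))} := by
    refine Ideal.mem_span_singleton'.2 ⟨(v : ℤ), ?_⟩
    have := congrArg (fun t : ℤ ↦ (t : Localization.Away (m : ℤ))) huv
    push_cast at this
    linear_combination this
  have h2 := one_sub_pow_mem_span h1 k
  have e : x - ((z * u ^ k : ℤ) : Localization.Away (m : ℤ)) =
      x * (1 - ((m : Localization.Away (m : ℤ)) * (u : ℤ)) ^ k) := by
    rw [mul_pow, Int.cast_mul, Int.cast_pow, ← hzk]; ring
  rw [e]
  exact Ideal.mul_mem_left _ _ h2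

/-- An integer lies in `(B) ⊆ ℤ[1/m]` only if `B ∣ z` (`B` prime to `m`). [cite: SerreSL2Congruence1970, §1.2] -/
theorem natCast_dvd_of_intCast_mem_span (hm : m ≠ 0) {B : ℕ} (hBc : B.Coprime m) {z : ℤ}
    (hz : (z : Localization.Away (m : ℤ)) ∈ Ideal.span {((B : ℕ) : Localization.Away (m : ℤ))}) :
    (B : ℤ) ∣ z := by
  obtain ⟨y, hy⟩ := Ideal.mem_span_singleton'.1 hz
  obtain ⟨w, k, hwk⟩ := exists_mul_pow_eq_intCast y
  -- `z mᵏ = B w` in `ℤ`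
  have h1 : ((z * (m : ℤ) ^ k : ℤ) : Localization.Away (m : ℤ)) =
      (((B : ℤ) * w : ℤ) : Localization.Away (m : ℤ)) := by
    push_cast
    rw [← hy, ← hwk]; ring
  have hinj := algebraMap_int_away_injective hm
  have h2 : z * (m : ℤ) ^ k = (B : ℤ) * w := by
    apply hinj
    simpa only [eq_intCast] using h1
  have hcop : IsCoprime ((B : ℤ)) ((m : ℤ) ^ k) :=
    (Nat.isCoprime_iff_coprime.2 hBc).pow_right
  exact hcop.dvd_of_dvd_mul_right ⟨w, h2⟩

/-- **`ℤ[1/m]/(B) ≃ ℤ/B ≃ ZMod B` for `B` prime to `m`.** [cite: SerreSL2Congruence1970, §1.2] -/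
theorem nonempty_zmod_ringEquiv_quotient (hm : m ≠ 0) {B : ℕ} (hBc : B.Coprime m) :
    Nonempty (ZMod B ≃+* Localization.Away (m : ℤ) ⧸
      Ideal.span {((B : ℕ) : Localization.Away (m : ℤ))}) := by
  set f : ℤ →+* Localization.Away (m : ℤ) ⧸ Ideal.span {((B : ℕ) : Localization.Away (m : ℤ))} :=
    (Ideal.Quotient.mk _).comp (Int.castRingHom _) with hf
  have hsurj : Function.Surjective f := by
    intro y
    obtain ⟨x, rfl⟩ := Ideal.Quotient.mk_surjective y
    obtain ⟨z, hz⟩ := exists_intCast_sub_mem hBc x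
    refine ⟨z, ?_⟩
    rw [hf, RingHom.comp_apply, eq_intCast, eq_comm, Ideal.Quotient.eq]
    exact hz
  have hker : RingHom.ker f = Ideal.span {(B : ℤ)} := by
    ext z
    rw [RingHom.mem_ker, hf, RingHom.comp_apply, eq_intCast, Ideal.Quotient.eq_zero_iff_mem]
    constructor
    · exact fun hz ↦ Ideal.mem_span_singleton.2 (natCast_dvd_of_intCast_mem_span hm hBc hz)
    · intro hz
      obtain ⟨c, rfl⟩ := Ideal.mem_span_singleton.1 hz
      rw [Int.cast_mul, Int.cast_natCast]
      exact Ideal.mul_mem_right _ _ (Ideal.mem_span_singleton_self _)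
  exact ⟨(Int.quotientSpanNatEquivZMod B).symm.trans
    ((Ideal.quotEquivOfEq hker.symm).trans (RingHom.quotientKerEquivOfSurjective hsurj))⟩

/-- `ℤ[1/m]/(B)` has `B` elements (`B ≥ 1` prime to `m`). [cite: SerreSL2Congruence1970, §1.2] -/
theorem natCard_quotient_span_natCast (hm : m ≠ 0) {B : ℕ} (hBc : B.Coprime m) :
    Nat.card (Localization.Away (m : ℤ) ⧸ Ideal.span {((B : ℕ) : Localization.Away (m : ℤ))}) = B := by
  obtain ⟨e⟩ := nonempty_zmod_ringEquiv_quotient hm hBc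
  rw [← Nat.card_congr e.toEquiv, Nat.card_zmod]

/-- `ℤ[1/m]/J` is finite for every non-zero ideal `J`. [cite: SerreSL2Congruence1970, §1.2
(`Le quotient A/𝔮 est fini`)] -/
theorem finite_quotient_of_ne_bot (hm : m ≠ 0) {J : Ideal (Localization.Away (m : ℤ))} (hJ : J ≠ ⊥) :
    Finite (Localization.Away (m : ℤ) ⧸ J) := by
  obtain ⟨B, hB, -, rfl⟩ := exists_coprime_eq_span hm hJ
  exact Literature.GroupTheory.ArithmeticGroups.finite_quotient_away_span_natCast hB.ne'

/-- For a prime `p ∤ m`: `(p)` is a maximal ideal of `ℤ[1/m]` (residue field `𝔽_p`).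
[cite: SerreSL2Congruence1970, §1.1] -/
theorem isMaximal_span_natCast_prime (hm : m ≠ 0) {p : ℕ} (hp : p.Prime) (hpm : ¬ p ∣ m) :
    (Ideal.span {((p : ℕ) : Localization.Away (m : ℤ))}).IsMaximal := by
  haveI : Fact p.Prime := ⟨hp⟩
  obtain ⟨e⟩ := nonempty_zmod_ringEquiv_quotient hm ((Nat.Prime.coprime_iff_not_dvd hp).2 hpm)
  refine Ideal.Quotient.maximal_of_isField _ ?_
  exact MulEquiv.isField (Field.toIsField (ZMod p)) e.symm.toMulEquiv

/-- For a prime `p ∤ m`, every unit of `ℤ[1/m]/(p) ≃ 𝔽_p` has order dividing `p - 1`.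
[cite: SerreSL2Congruence1970, §2.3 (end of the proof of Lemme 3)] -/
theorem orderOf_units_dvd_sub_one (hm : m ≠ 0) {p : ℕ} (hp : p.Prime) (hpm : ¬ p ∣ m)
    (u : (Localization.Away (m : ℤ) ⧸ Ideal.span {((p : ℕ) : Localization.Away (m : ℤ))})ˣ) :
    orderOf u ∣ p - 1 := by
  classical
  haveI : Fact p.Prime := ⟨hp⟩
  obtain ⟨e⟩ := nonempty_zmod_ringEquiv_quotient hm ((Nat.Prime.coprime_iff_not_dvd hp).2 hpm)
  set v : (ZMod p)ˣ := Units.map e.symm.toMonoidHom u with hv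
  have horder : orderOf v = orderOf u := by
    rw [hv]
    exact (Units.mapEquiv e.symm.toMulEquiv).orderOf_eq u
  rw [← horder, ← ZMod.card_units p, ← Nat.card_eq_fintype_card]
  exact orderOf_dvd_natCard v

/-- A prime `p > m` does not divide `m` (for `m ≥ 1`), so it is a prime of `A_S = ℤ[1/m]`.
[cite: SerreSL2Congruence1970, §1.1] -/
theorem not_dvd_of_lt (hm : m ≠ 0) {p : ℕ} (hmp : m < p) : ¬ p ∣ m :=
  fun h ↦ absurd (Nat.le_of_dvd (Nat.pos_of_ne_zero hm) h) (not_le.2 hmp)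

/-- `IsCoprime x B` in `ℤ[1/m]` for `x ≡ z (mod B)` forces `IsCoprime z B` in `ℤ` (`B` prime to `m`):
the hypothesis "`x` prime to `𝔪`" of the Dirichlet theorem, moved to `ℤ`.
[cite: BassMilnorSerre1967, Appendix (A.10)] -/
theorem isCoprime_int_of_sub_mem (hm : m ≠ 0) {B : ℕ} (hBc : B.Coprime m)
    {x : Localization.Away (m : ℤ)} {z : ℤ}
    (hxz : x - z ∈ Ideal.span {((B : ℕ) : Localization.Away (m : ℤ))})
    (hx : IsCoprime x ((B : ℕ) : Localization.Away (m : ℤ))) : IsCoprime z (B : ℤ) := by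
  obtain ⟨s, t, hst⟩ := hx
  -- `s z ≡ 1 (mod B)` in `A`; write `s ≡ s₀`, then `s₀ z - 1 ∈ (B) ∩ ℤ`
  obtain ⟨s₀, hs₀⟩ := exists_intCast_sub_mem hBc s
  have h1 : ((s₀ * z - 1 : ℤ) : Localization.Away (m : ℤ)) ∈
      Ideal.span {((B : ℕ) : Localization.Away (m : ℤ))} := by
    have e : ((s₀ * z - 1 : ℤ) : Localization.Away (m : ℤ)) =
        -((s - s₀) * z) - s * (x - z) - t * (B : ℕ) + (s * x + t * (B : ℕ) - 1) := by
      push_cast; ring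
    rw [e, hst, sub_self, add_zero]
    refine Ideal.sub_mem _ (Ideal.sub_mem _ (Submodule.neg_mem _ (Ideal.mul_mem_right _ _ hs₀))
      (Ideal.mul_mem_left _ _ hxz)) (Ideal.mul_mem_left _ _ (Ideal.mem_span_singleton_self _))
  obtain ⟨c, hc⟩ := natCast_dvd_of_intCast_mem_span hm hBc h1
  exact ⟨s₀, -c, by linear_combination hc⟩

/-! ### Dirichlet's theorem in `ℤ[1/m]` -/

/-- **Dirichlet's theorem on primes in arithmetic progressions, in `ℤ[1/m]`**: for `B ≥ 1` prime to
`m` and `x ∈ ℤ[1/m]` prime to `B`, the class `x + B·ℤ[1/m]` contains rational primes `p > n` for every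
`n` (Mathlib's `Nat.forall_exists_prime_gt_and_zmodEq` applied to an integer representative of `x`).
This is the form in which Bass–Milnor–Serre (A.10)–(A.11) and Serre's §2.3 are used over `ℚ`.
[cite: BassMilnorSerre1967, Appendix (A.10)–(A.11)] -/
theorem exists_prime_natCast_sub_mem (hm : m ≠ 0) {B : ℕ} (hB : 0 < B) (hBc : B.Coprime m)
    {x : Localization.Away (m : ℤ)} (hx : IsCoprime x ((B : ℕ) : Localization.Away (m : ℤ))) (n : ℕ) :
    ∃ p : ℕ, n < p ∧ p.Prime ∧
      ((p : ℕ) : Localization.Away (m : ℤ)) - x ∈ Ideal.span {((B : ℕ) : Localization.Away (m : ℤ))} := by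
  obtain ⟨z, hxz⟩ := exists_intCast_sub_mem hBc x
  have hzB : IsCoprime z (B : ℤ) := isCoprime_int_of_sub_mem hm hBc hxz hx
  obtain ⟨p, hpn, hp, hpz⟩ := Nat.forall_exists_prime_gt_and_zmodEq n hB.ne' hzB
  refine ⟨p, hpn, hp, ?_⟩
  obtain ⟨c, hc⟩ := (Int.modEq_iff_dvd.1 hpz.symm)
  -- `p - x = (p - z) + (z - x)`
  have e : ((p : ℕ) : Localization.Away (m : ℤ)) - x =
      ((p - z : ℤ) : Localization.Away (m : ℤ)) + -(x - z) := by push_cast; ring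
  rw [e]
  refine Ideal.add_mem _ ?_ (Submodule.neg_mem _ hxz)
  rw [hc, Int.cast_mul, Int.cast_natCast]
  exact Ideal.mul_mem_right _ _ (Ideal.mem_span_singleton_self _)

/-- If `IsCoprime a b` and `(b) = (c)` then `IsCoprime a c` (Serre's hypothesis "`a₀` inversible
modulo `𝔯`" only depends on the ideal `𝔯 = (b)`). [cite: SerreSL2Congruence1970, §2.2 Lemme 3] -/
theorem isCoprime_of_span_singleton_eq {R : Type*} [CommRing R] {a b c : R} (hab : IsCoprime a b)
    (h : Ideal.span {b} = Ideal.span {c}) : IsCoprime a c := by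
  have hb : b ∈ Ideal.span {c} := h ▸ Ideal.mem_span_singleton_self b
  obtain ⟨d, rfl⟩ := Ideal.mem_span_singleton'.1 hb
  exact hab.of_mul_right_right

/-! ### Serre's Lemme 3 over `ℤ[1/m]` -/

/-- The units of `ℤ[1/m]/(π)` have order prime to `L` when `(π) = (p)` for a prime `p ∤ m` with
`L ∤ p - 1`. [cite: SerreSL2Congruence1970, §2.3 (end of the proof of Lemme 3)] -/
theorem not_dvd_orderOf_of_span_eq (hm : m ≠ 0) {p : ℕ} (hp : p.Prime) (hpm : ¬ p ∣ m) {L : ℕ}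
    (hL : ¬ L ∣ p - 1) {π : Localization.Away (m : ℤ)}
    (hπ : Ideal.span {π} = Ideal.span {((p : ℕ) : Localization.Away (m : ℤ))})
    (u : (Localization.Away (m : ℤ) ⧸ Ideal.span {π})ˣ) : ¬ L ∣ orderOf u := by
  intro hLu
  set e := Ideal.quotEquivOfEq hπ with he
  have horder : orderOf (Units.mapEquiv e.toMulEquiv u) = orderOf u :=
    (Units.mapEquiv e.toMulEquiv).orderOf_eq u
  have hdvd := orderOf_units_dvd_sub_one hm hp hpm (Units.mapEquiv e.toMulEquiv u)
  rw [horder] at hdvd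
  exact hL (hLu.trans hdvd)

/-- **Serre 1970, §2.2 Lemme 3 (= Bass–Milnor–Serre Ch. I Thm. 3.2) for `A = ℤ[1/m]`** (`K = ℚ` has
the real place, so `m = Card μ = 2` and `lᵉ ∥ 2`, `e = v_l(2)`): for `a, b ∈ ℤ[1/m]` coprime with
`b ≠ 0` and a prime `l` there is `t` with `a + tb ≠ 0` such that the unit group of `ℤ[1/m]/(a + tb)`
has **no element of order divisible by `l^{e+1}`**.  Proof (Serre §2.3 / BMS Thm. 3.2 over `ℚ`):
with `(b) = (B)`, `B` prime to `m`, `a ≡ z (mod B)`, `L = l^{e+1} ≥ 3`, Dirichlet gives a rational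
prime `p ≡ r (mod BL)` where `r ≡ ±z (mod B)` is chosen with `r ≢ 1 (mod L)` (using the unit `-1`
when `L ∣ B` forces the class); then `a + tb = ±p`, `(a + tb) = (p)`, and the units of
`ℤ[1/m]/(p) ≅ 𝔽_p` have order dividing `p - 1 ≢ 0 (mod L)`.
[cite: SerreSL2Congruence1970, §2.2 Lemme 3] -/
theorem exists_add_mul_forall_not_dvd_orderOf (hm : m ≠ 0) {a b : Localization.Away (m : ℤ)}
    (hab : IsCoprime a b) (hb : b ≠ 0) {l : ℕ} (hl : l.Prime) :
    ∃ t : Localization.Away (m : ℤ), a + t * b ≠ 0 ∧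
      ∀ u : (Localization.Away (m : ℤ) ⧸ Ideal.span {a + t * b})ˣ,
        ¬ l ^ (padicValNat l 2 + 1) ∣ orderOf u := by
  classical
  haveI := SL2Rel.isDomain_away hm
  set k : ℕ := padicValNat l 2 + 1 with hk
  set L : ℕ := l ^ k with hL
  haveI : Fact l.Prime := ⟨hl⟩
  have hL3 : 3 ≤ L := by
    by_cases h2 : l = 2
    · subst h2
      have : padicValNat 2 2 = 1 := padicValNat.self one_lt_two
      rw [hL, hk, this]
      norm_num
    · have h0 : padicValNat l 2 = 0 :=
        padicValNat.eq_zero_of_not_dvd fun h ↦ h2 ((Nat.prime_dvd_prime_iff_eq hl Nat.prime_two).mp h)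
      rw [hL, hk, h0, zero_add, pow_one]
      have := hl.two_le
      omega
  haveI : Fact (2 < L) := ⟨by omega⟩
  have hL0 : L ≠ 0 := by omega
  -- `(b) = (B)`, `B ≥ 1` prime to `m`; `a ≡ z (mod B)` with `(z, B) = 1`
  obtain ⟨B, hB, hBc, hbB⟩ := exists_coprime_eq_span hm (J := Ideal.span {b})
    (by rwa [Ne, Ideal.span_singleton_eq_bot])
  obtain ⟨z, haz⟩ := exists_intCast_sub_mem hBc a
  have haB : IsCoprime a ((B : ℕ) : Localization.Away (m : ℤ)) := isCoprime_of_span_singleton_eq hab hbB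
  have hzB : IsCoprime z (B : ℤ) := isCoprime_int_of_sub_mem hm hBc haz haB
  -- the class `r (mod BL)` and the sign `s`
  obtain ⟨r, s, hrBL, hs, hsrz, hr1⟩ : ∃ r s : ℤ, IsCoprime r ((B : ℤ) * L) ∧ (s = 1 ∨ s = -1) ∧
      (B : ℤ) ∣ s * r - z ∧ (r : ZMod L) ≠ 1 := by
    by_cases hlB : l ∣ B
    · -- `l ∣ B`: `r = ±z`
      have hzL : IsCoprime z (L : ℤ) := by
        obtain ⟨B', hB'⟩ := hlB
        have hzl : IsCoprime z (l : ℤ) := by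
          rw [hB', Nat.cast_mul] at hzB
          exact hzB.of_mul_right_left
        rw [hL, Nat.cast_pow]
        exact hzl.pow_right
      by_cases hz1 : ((z : ℤ) : ZMod L) = 1
      · refine ⟨-z, -1, (hzB.mul_right hzL).neg_left, Or.inr rfl, ⟨0, by ring⟩, ?_⟩
        rw [Int.cast_neg, hz1]
        exact ZMod.neg_one_ne_one
      · exact ⟨z, 1, hzB.mul_right hzL, Or.inl rfl, ⟨0, by ring⟩, hz1⟩
    · -- `l ∤ B`: Chinese remainder, `r ≡ z (mod B)`, `r ≡ -1 (mod L)`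
      have hBL : IsCoprime (B : ℤ) (L : ℤ) := by
        rw [hL, Nat.cast_pow]
        exact (Nat.isCoprime_iff_coprime.2 ((Nat.Prime.coprime_iff_not_dvd hl).2 hlB).symm).pow_right
      obtain ⟨u, v, huv⟩ := hBL
      refine ⟨z * (v * L) + (-1) * (u * B), 1, ?_, Or.inl rfl, ?_, ?_⟩
      · refine IsCoprime.mul_right ?_ ?_
        · have e : z * (v * L) + (-1) * (u * B) = z + (B : ℤ) * (-(u * (z + 1))) := by
            linear_combination z * huv
          rw [e]
          exact hzB.add_mul_left_left _
        · have e : z * (v * L) + (-1) * (u * B) = -1 + (L : ℤ) * (v * (z + 1)) := by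
            linear_combination -huv
          rw [e]
          exact (isCoprime_one_left.neg_left).add_mul_left_left _
      · exact ⟨-(u * (z + 1)), by linear_combination z * huv⟩
      · have e : ((z * (v * L) + (-1) * (u * B) : ℤ) : ZMod L) = -1 + (L : ZMod L) * (v * (z + 1)) := by
          have := congrArg (fun t : ℤ ↦ (t : ZMod L)) huv
          push_cast at this ⊢
          linear_combination -this
        rw [e, ZMod.natCast_self, zero_mul, add_zero]
        exact ZMod.neg_one_ne_one
  -- Dirichlet: a prime `p ≡ r (mod BL)`, `p > m`
  have hBL0 : B * L ≠ 0 := mul_ne_zero hB.ne' hL0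
  obtain ⟨p, hpm', hp, hpr⟩ := Nat.forall_exists_prime_gt_and_zmodEq m hBL0
    (by exact_mod_cast hrBL : IsCoprime r ((B * L : ℕ) : ℤ))
  have hpm : ¬ p ∣ m := not_dvd_of_lt hm hpm'
  -- `L ∤ p - 1`
  have hp1 : ¬ L ∣ p - 1 := by
    intro hdvd
    have h1 : ((p : ℤ) : ZMod L) = 1 := by
      have : 1 ≡ p [MOD L] := (Nat.modEq_iff_dvd' hp.one_le).2 hdvd
      rw [Int.cast_natCast, ← (ZMod.natCast_eq_natCast_iff _ _ _).2 this, Nat.cast_one]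
    have h2 : ((p : ℤ) : ZMod L) = (r : ZMod L) :=
      (ZMod.intCast_eq_intCast_iff _ _ _).2 (Int.ModEq.of_mul_left (B : ℤ) (by exact_mod_cast hpr))
    exact hr1 (h2.symm.trans h1)
  -- `π = s p ≡ a (mod b)`, so `π = a + t b`
  have hsu : IsUnit ((s : ℤ) : Localization.Away (m : ℤ)) := by
    rcases hs with rfl | rfl
    · simp
    · rw [Int.cast_neg, Int.cast_one]
      exact (isUnit_one (M := Localization.Away (m : ℤ))).neg
  set π : Localization.Away (m : ℤ) := (s : ℤ) * ((p : ℕ) : Localization.Away (m : ℤ)) with hπdef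
  have hπa : π - a ∈ Ideal.span {b} := by
    rw [hbB]
    obtain ⟨c₁, hc₁⟩ := (Int.modEq_iff_dvd.1 hpr.symm)
    obtain ⟨c₂, hc₂⟩ := hsrz
    push_cast at hc₁
    -- `s p - z = s (p - r) + (s r - z)`
    have key : s * (p : ℤ) - z = (B : ℤ) * (s * L * c₁ + c₂) := by
      linear_combination s * hc₁ + hc₂
    have e : π - a = (((B : ℤ) * (s * L * c₁ + c₂) : ℤ) : Localization.Away (m : ℤ)) + -(a - z) := by
      rw [← key, hπdef]; push_cast; ring
    rw [e]
    refine Ideal.add_mem _ ?_ (Submodule.neg_mem _ haz)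
    push_cast
    exact Ideal.mul_mem_right _ _ (Ideal.mem_span_singleton_self _)
  obtain ⟨t, ht⟩ := Ideal.mem_span_singleton'.1 hπa
  -- `ht : t * b = π - a`
  have hat : a + t * b = π := by rw [ht]; ring
  have hπp : Ideal.span {π} = Ideal.span {((p : ℕ) : Localization.Away (m : ℤ))} := by
    rw [hπdef]
    exact Ideal.span_singleton_mul_left_unit hsu _
  refine ⟨t, ?_, ?_⟩
  · rw [hat, hπdef]
    exact mul_ne_zero hsu.ne_zero (natCast_ne_zero_away hm hp.ne_zero)
  · rw [hat]
    exact not_dvd_orderOf_of_span_eq hm hp hpm hp1 hπp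

/-! ### Units: a unit of infinite order; Lagrange modulo `J`; additive subgroups stable under units -/

/-- **`ℤ[1/m]` has a unit of infinite order** (`m ≥ 2`). [cite: SerreSL2Congruence1970, §1.1
("`U` est fini si et seulement si `s = 1`")] -/
theorem exists_unit_pow_ne_one (hm : 2 ≤ m) :
    ∃ v : (Localization.Away (m : ℤ))ˣ, ∀ n : ℕ, n ≠ 0 → v ^ n ≠ 1 := by
  refine ⟨(isUnit_natCast_self (m := m)).unit, fun n hn h ↦ ?_⟩
  have h1 : ((m : ℕ) : Localization.Away (m : ℤ)) ^ n = 1 := by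
    have := congrArg (fun w : (Localization.Away (m : ℤ))ˣ ↦ (w : Localization.Away (m : ℤ))) h
    simpa [Units.val_pow_eq_pow_val] using this
  have h2 : ((m : ℤ) ^ n : ℤ) = 1 := by
    apply algebraMap_int_away_injective (by omega : m ≠ 0)
    simpa using h1
  have h3 : m ^ n = 1 := by exact_mod_cast h2
  exact (Nat.one_lt_pow hn hm).ne' h3

/-- The unit `m` of `ℤ[1/m]`, as a unit, coerces to `m`. [cite: SerreSL2Congruence1970, §1.1] -/
theorem val_unit_natCast_self :
    ((isUnit_natCast_self (m := m)).unit : Localization.Away (m : ℤ)) = (m : ℕ) :=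
  IsUnit.unit_spec _

/-- Every `N`-th power of a unit is `≡ 1 (mod J)`, `N = #(R ⧸ J)ˣ` (Lagrange; `N = 0` if infinite) —
the exponent `N₀` of Vaserstein's proof of Lemma 4. [cite: Vaserstein1972SL2, Lemma 4 (proof of Case 2)] -/
theorem units_pow_card_sub_one_mem {R : Type*} [CommRing R] (J : Ideal R) (v : Rˣ) :
    ((v ^ Nat.card (R ⧸ J)ˣ : Rˣ) : R) - 1 ∈ J := by
  have h := pow_card_eq_one' (G := (R ⧸ J)ˣ) (x := Units.map (Ideal.Quotient.mk J : R →* R ⧸ J) v)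
  have h' : Ideal.Quotient.mk J (((v ^ Nat.card ((R ⧸ J)ˣ) : Rˣ) : R)) = 1 := by
    have := congrArg (fun w : (R ⧸ J)ˣ ↦ (w : R ⧸ J)) h
    simp only [Units.val_pow_eq_pow_val, Units.coe_map, MonoidHom.coe_coe, Units.val_one] at this
    rw [Units.val_pow_eq_pow_val, map_pow]
    exact this
  rw [← (Ideal.Quotient.mk J).map_one, Ideal.Quotient.eq] at h'
  exact h'

/-- **Substitute for "the powers of the units span the field"** (file VIII of the `𝓞_F` story): an
additive subgroup `X` of `ℤ[1/m]` with `vᴺ X ⊆ X` for every unit `v` (`N ≥ 1`) is stable under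
multiplication by `ℤ[1/m] = ℤ[mᴺ, m⁻ᴺ]`: `x₀ ∈ X` gives `x₀ y ∈ X` for all `y`.
[cite: Vaserstein1972SL2, Lemma 4 (Case 2, last step)] -/
theorem mul_mem_of_units_pow_mul_mem {N : ℕ} (hN : N ≠ 0)
    (X : AddSubgroup (Localization.Away (m : ℤ)))
    (hX : ∀ v : (Localization.Away (m : ℤ))ˣ, ∀ x ∈ X,
      ((v ^ N : (Localization.Away (m : ℤ))ˣ) : Localization.Away (m : ℤ)) * x ∈ X)
    {x₀ : Localization.Away (m : ℤ)} (hx₀ : x₀ ∈ X) (y : Localization.Away (m : ℤ)) : x₀ * y ∈ X := by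
  set u : (Localization.Away (m : ℤ))ˣ := (isUnit_natCast_self (m := m)).unit with hu
  have huval : (u : Localization.Away (m : ℤ)) = (m : ℕ) := val_unit_natCast_self
  obtain ⟨N', rfl⟩ : ∃ N', N = N' + 1 := ⟨N - 1, by omega⟩
  -- `X u⁻¹ ⊆ X`: `x u⁻¹ = (m^{N'} x) · (u⁻¹)^{N'+1}`
  have hinv : ∀ x ∈ X, x * ((u⁻¹ : (Localization.Away (m : ℤ))ˣ) : Localization.Away (m : ℤ)) ∈ X := by
    intro x hx
    have h1 : (m ^ N' : ℕ) • x ∈ X := X.nsmul_mem hx _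
    have h2 := hX u⁻¹ _ h1
    have e : (((u⁻¹) ^ (N' + 1) : (Localization.Away (m : ℤ))ˣ) : Localization.Away (m : ℤ)) *
        ((m ^ N' : ℕ) • x) = x * ((u⁻¹ : (Localization.Away (m : ℤ))ˣ) : Localization.Away (m : ℤ)) := by
      rw [nsmul_eq_mul, Nat.cast_pow, ← huval, Units.val_pow_eq_pow_val, pow_succ]
      have hui : ((u⁻¹ : (Localization.Away (m : ℤ))ˣ) : Localization.Away (m : ℤ)) * u = 1 := u.inv_mul
      have : ((u⁻¹ : (Localization.Away (m : ℤ))ˣ) : Localization.Away (m : ℤ)) ^ N' *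
          (u : Localization.Away (m : ℤ)) ^ N' = 1 := by rw [← mul_pow, hui, one_pow]
      linear_combination (x * ((u⁻¹ : (Localization.Away (m : ℤ))ˣ) : Localization.Away (m : ℤ))) * this
    rw [e] at h2
    exact h2
  have hinvk : ∀ k : ℕ, ∀ x ∈ X,
      x * ((u⁻¹ : (Localization.Away (m : ℤ))ˣ) : Localization.Away (m : ℤ)) ^ k ∈ X := by
    intro k
    induction k with
    | zero => intro x hx; simpa using hx
    | succ k ih =>
      intro x hx
      rw [pow_succ, ← mul_assoc]
      exact hinv _ (ih x hx)
  -- `y = z (u⁻¹)^k`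
  obtain ⟨z, k, hzk⟩ := exists_mul_pow_eq_intCast y
  have hy : y = (z : Localization.Away (m : ℤ)) *
      ((u⁻¹ : (Localization.Away (m : ℤ))ˣ) : Localization.Away (m : ℤ)) ^ k := by
    rw [← hzk, ← huval, mul_assoc, ← mul_pow, u.mul_inv, one_pow, mul_one]
  rw [hy, ← mul_assoc, show x₀ * (z : Localization.Away (m : ℤ)) = z • x₀ by rw [zsmul_eq_mul, mul_comm]]
  exact hinvk k _ (X.zsmul_mem hx₀ z)

end SerreSL2.Away

end Literature.NumberTheory.Automorphic
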